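import Literature.Computability.Complexity.OrbitDeciderStepper
import Literature.Computability.Complexity.OrbitDecidersExists
import Literature.Computability.Complexity.CountingHierarchyPSPACE
import Literature.Computability.Complexity.TruthTableClosure
import Literature.Computability.Complexity.BranchingFn
import Literature.Computability.Complexity.StackBricks
import Literature.Computability.Complexity.StringCopy
import Literature.Computability.Complexity.Reductions
import HarnessLib

/-!
# Closure properties of `PSPACE`: preimages, bounded quantifiers, majority, and Boolean combinations through a complete set

Topic `Literature/Computability/Complexity` (space-bounded classes of `Space.lean`; the orbit
deciders of `OrbitDeciders.lean`). A toolkit file collecting, with the names consumers look for,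
the closure properties of `PSPACE` that the tree proves through orbit deciders, and adding the
Boolean combinations of two `PSPACE` languages obtained through a `PSPACE`-complete set:

* `preimage_mem_PSPACE`, `mem_PSPACE_of_karpReducible'` — `PSPACE` is closed downwards under
  polynomial-time (Karp) reductions (Arora–Barak Def. 4.9; `OrbitDecider.preimage`);
* `inter_P_mem_PSPACE`, `union_P_mem_PSPACE` — intersections and unions with `P` languages;
* `polyExists_mem_PSPACE`, `polyForall_mem_PSPACE`, `pMajority_mem_PSPACE` — closure under
  polynomially bounded `∃`, `∀` (Arora–Barak Thm. 4.2 area: `NP ⊆ PSPACE` by reusing space;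
  the tree's `OrbitDecider.polyExists`; the class form `polyExists PSPACE ⊆ PSPACE` is the tree's
  `polyExists_PSPACE_subset_PSPACE_holds` / `polyExists_PSPACE_subset_PSPACE_of_queryLoop`) and
  under the majority quantifier (`C·PSPACE ⊆ PSPACE`, the tree's `pMajority_PSPACE_subset_PSPACE`);
* `inter_mem_PSPACE_of_complete`, `union_mem_PSPACE_of_complete` — **intersection and union of
  two `PSPACE` languages**, through a Karp-`PSPACE`-complete `B`: both languages Karp-reduce to
  `B`, their intersection (union) is a two-query truth-table reduction to `B` (`ttLang`,
  `TruthTableClosure.lean`: queries `f₁ x`, `f₂ x`, evaluator "no answer bit is `0`" / "some answer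
  bit is `1`"), hence in `P^B ⊆ PSPACE` (`PRel_subset_PSPACE_of_mem_PSPACE_holds`); with
  `exists_isComplete_PSPACE_holds` (`SpaceTMSATHard.lean`, not imported here to keep the import
  graph light) the hypothesis is dischargeable, and the consumer (Fenner–Fortnow–Kurtz–Li Thm.
  6.18 (2) rerelativized, `Literature/Barriers/QuantumAdvantage/FFKLGenericCollapse.lean`) has
  such a `B` in hand anyway.

All theorems are proved; no definitions are introduced.

## References

* S. Arora, B. Barak, *Computational Complexity: A Modern Approach*, CUP 2009, §4.1–4.2
  (Thm. 4.2; Def. 4.9: `PSPACE`-hardness under `≤ₚ`, closure downwards), §17 (`PP ⊆ PSPACE`)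
  [AroraBarakCC2009].
* R. Ladner, N. Lynch, A. Selman, *A comparison of polynomial time reducibilities*, TCS 1
  (1975), §3 (truth-table reducibility implies Turing reducibility) [LadnerLynchSelman1975].
-/

noncomputable section

namespace Literature.Computability.Complexity

open _root_.Computability Polynomial Brick TTClosure
open scoped Notation

/-! ### Preimages, Karp reductions, intersections and unions with `P` -/

/-- **`PSPACE` is closed under polynomial-time preimages** (orbit deciders pull back along `FP`
maps). [cite: AroraBarakCC2009, §4.2 (Def. 4.9)] -/
theorem preimage_mem_PSPACE {L : Language Bool} (hL : L ∈ PSPACE) {f : List Bool → List Bool}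
    (hf : f ∈ FP) : f ⁻¹' L ∈ PSPACE :=
  ((orbitDecider_of_mem_PSPACE hL).preimage hf).mem_PSPACE

/-- **`PSPACE` is closed downwards under Karp reductions.** [cite: AroraBarakCC2009, §4.2 (Def. 4.9)] -/
theorem mem_PSPACE_of_karpReducible' {L A : Language Bool} (h : L ≤ₚ A) (hA : A ∈ PSPACE) :
    L ∈ PSPACE :=
  mem_PSPACE_of_karpReducible_orbitDecider (orbitDecider_of_mem_PSPACE hA) h

/-- `PSPACE` absorbs intersections with `P` languages. [cite: AroraBarakCC2009, §4.1] -/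
theorem inter_P_mem_PSPACE {L₁ L₂ : Language Bool} (h₁ : L₁ ∈ Classes.P) (h₂ : L₂ ∈ PSPACE) :
    L₁ ⊓ L₂ ∈ PSPACE :=
  inter_mem_of_preimage_closed (fun _ hL _ hg => preimage_mem_PSPACE hL hg) P_subset_PSPACE_holds
    h₁ h₂

/-- `PSPACE` absorbs unions with `P` languages. [cite: AroraBarakCC2009, §4.1] -/
theorem union_P_mem_PSPACE {L₁ L₂ : Language Bool} (h₁ : L₁ ∈ Classes.P) (h₂ : L₂ ∈ PSPACE) :
    L₁ ⊔ L₂ ∈ PSPACE :=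
  union_mem_of_preimage_closed (fun _ hL _ hg => preimage_mem_PSPACE hL hg) P_subset_PSPACE_holds
    h₁ h₂

/-! ### Bounded quantifiers and majority -/

/-- **`PSPACE` is closed under polynomially bounded existential quantification** (run through the
witnesses reusing space): `{x | ∃ y, |y| ≤ p(|x|) ∧ ⟨x, y⟩ ∈ A} ∈ PSPACE` for `A ∈ PSPACE`
(membership form; the class form `polyExists PSPACE ⊆ PSPACE` is the tree's
`polyExists_PSPACE_subset_PSPACE_holds`, `SpaceOraclesProofs.lean`).
[cite: AroraBarakCC2009, Thm. 4.2 and §4.1 (NP ⊆ PSPACE)] -/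
theorem polyExists_mem_PSPACE {A : Language Bool} (hA : A ∈ PSPACE) (p : Polynomial ℕ) :
    {x | ∃ y : List Bool, y.length ≤ p.eval x.length ∧ boolPair x y ∈ A} ∈ PSPACE :=
  mem_PSPACE_polyExists_of_orbitDecider (orbitDecider_of_mem_PSPACE hA) p

/-- **`PSPACE` is closed under polynomially bounded universal quantification**:
`{x | ∀ y, |y| ≤ p(|x|) → ⟨x, y⟩ ∈ A} ∈ PSPACE` for `A ∈ PSPACE` (complement of the bounded `∃`
of the complement). [cite: AroraBarakCC2009, Thm. 4.2 and §4.1] -/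
theorem polyForall_mem_PSPACE {A : Language Bool} (hA : A ∈ PSPACE) (p : Polynomial ℕ) :
    {x | ∀ y : List Bool, y.length ≤ p.eval x.length → boolPair x y ∈ A} ∈ PSPACE := by
  have h := compl_mem_PSPACE (polyExists_mem_PSPACE (compl_mem_PSPACE hA) p)
  have : {x | ∀ y : List Bool, y.length ≤ p.eval x.length → boolPair x y ∈ A} =
      {x | ∃ y : List Bool, y.length ≤ p.eval x.length ∧ boolPair x y ∈ Aᶜ}ᶜ := by
    ext x
    simp only [Set.mem_setOf_eq, Set.mem_compl_iff, not_exists, not_and]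
    exact forall_congr' fun y => ⟨fun h hy hn => hn (h hy), fun h hy => by_contra fun hn => h hy hn⟩
  rw [this]
  exact h

/-- `C·PSPACE ⊆ PSPACE`, membership form: a majority language over a `PSPACE` relation is in
`PSPACE`. [cite: AroraBarakCC2009, §17 (PP ⊆ PSPACE) with Thm. 4.2] -/
theorem pMajority_mem_PSPACE {L' : Language Bool} (hL' : L' ∈ PSPACE) (p : Polynomial ℕ)
    {L : Language Bool}
    (hL : ∀ x : List Bool, x ∈ L ↔ 1 / 2 < uniformProb (p.eval x.length) {y : List Bool | boolPair x y ∈ L'}) :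
    L ∈ PSPACE :=
  pMajority_PSPACE_subset_PSPACE ⟨L', hL', p, hL⟩

/-! ### Intersections and unions of two `PSPACE` languages through a complete set -/

section Complete

variable {B : Language Bool}

/-- Every `PSPACE` language Karp-reduces to a `PSPACE`-complete set (definitional). [cite: AroraBarakCC2009, Def. 4.9] -/
theorem karpReducible_of_isComplete (hB : IsComplete PSPACE B) {L : Language Bool} (hL : L ∈ PSPACE) :
    L ≤ₚ B :=
  hB.2 L hL

/-- The two-query generator: on `⟨x, 1ⁱ⟩` ask `f₁ x` for `i = 0` and `f₂ x` otherwise. [folklore] -/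
theorem twoQuery_mem_FP {f₁ f₂ : List Bool → List Bool} (hf₁ : f₁ ∈ FP) (hf₂ : f₂ ∈ FP) :
    iteFn (isNilFn ∘ sndP) (f₁ ∘ fstP) (f₂ ∘ fstP) ∈ FP :=
  iteFn_mem_FP (comp_mem_FP isNilFn_mem_FP sndP_mem_FP) (comp_mem_FP hf₁ fstP_mem_FP)
    (comp_mem_FP hf₂ fstP_mem_FP)

/-- The answer bits of the two-query reduction are `[f₁ x ∈ B], [f₂ x ∈ B]`. [folklore] -/
theorem ttBits_twoQuery (f₁ f₂ : List Bool → List Bool) (B : Language Bool) (x : List Bool) :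
    ttBits (iteFn (isNilFn ∘ sndP) (f₁ ∘ fstP) (f₂ ∘ fstP)) B x 2 =
      [B.boolIndicator (f₁ x), B.boolIndicator (f₂ x)] := by
  have h0 : iteFn (isNilFn ∘ sndP) (f₁ ∘ fstP) (f₂ ∘ fstP) (boolPair x []) = f₁ x := by
    rw [iteFn_apply_true (by simp [isNilFn])]
    simp
  have h1 : iteFn (isNilFn ∘ sndP) (f₁ ∘ fstP) (f₂ ∘ fstP) (boolPair x [true]) = f₂ x := by
    rw [iteFn_apply_false (by simp [isNilFn])]
    simp
  simp [ttBits, List.range_succ, h0, h1]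

/-- **The intersection of two `PSPACE` languages is in `PSPACE`** (given a Karp-`PSPACE`-complete
`B`): both reduce to `B`, and `x ∈ L₁ ∩ L₂` iff neither of the two answers `[f₁ x ∈ B]`,
`[f₂ x ∈ B]` is `0` — a two-query truth-table reduction, in `P^B ⊆ PSPACE`.
[cite: LadnerLynchSelman1975, §3] [cite: AroraBarakCC2009, §4.2 (Def. 4.9)] -/
theorem inter_mem_PSPACE_of_complete (hB : IsComplete PSPACE B) {L₁ L₂ : Language Bool}
    (h₁ : L₁ ∈ PSPACE) (h₂ : L₂ ∈ PSPACE) : L₁ ⊓ L₂ ∈ PSPACE := by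
  obtain ⟨f₁, hf₁, hr₁⟩ := karpReducible_of_isComplete hB h₁
  obtain ⟨f₂, hf₂, hr₂⟩ := karpReducible_of_isComplete hB h₂
  have hD : (sndP ⁻¹' NoBit false : Language Bool) ∈ Classes.P :=
    preimage_mem_P (NoBit_mem_P false) sndP_mem_FP
  have hmem := ttLang_mem_PRel (Q := iteFn (isNilFn ∘ sndP) (f₁ ∘ fstP) (f₂ ∘ fstP))
    (q := Polynomial.C 2) (D := sndP ⁻¹' NoBit false) (twoQuery_mem_FP hf₁ hf₂) hD B
  have heq : ∀ x, x ∈ ttLang (iteFn (isNilFn ∘ sndP) (f₁ ∘ fstP) (f₂ ∘ fstP)) (Polynomial.C 2)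
      (sndP ⁻¹' NoBit false) B ↔ x ∈ L₁ ∧ x ∈ L₂ := by
    intro x
    rw [mem_ttLang_iff, eval_C, ttBits_twoQuery]
    have e₁ : x ∈ L₁ ↔ B.boolIndicator (f₁ x) = true := (hr₁ x).trans (Set.mem_iff_boolIndicator _ _)
    have e₂ : x ∈ L₂ ↔ B.boolIndicator (f₂ x) = true := (hr₂ x).trans (Set.mem_iff_boolIndicator _ _)
    rw [e₁, e₂]
    show sndP (boolPair x [B.boolIndicator (f₁ x), B.boolIndicator (f₂ x)]) ∈ NoBit false ↔ _
    rw [sndP_boolPair, mem_NoBit]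
    cases B.boolIndicator (f₁ x) <;> cases B.boolIndicator (f₂ x) <;> simp
  have hset : L₁ ⊓ L₂ = ttLang (iteFn (isNilFn ∘ sndP) (f₁ ∘ fstP) (f₂ ∘ fstP)) (Polynomial.C 2)
      (sndP ⁻¹' NoBit false) B := Set.ext fun x => (heq x).symm
  rw [hset]
  exact PRel_subset_PSPACE_of_mem_PSPACE_holds hB.1 hmem

/-- **The union of two `PSPACE` languages is in `PSPACE`** (given a Karp-`PSPACE`-complete `B`):
the same two-query reduction with the evaluator "some answer bit is `1`".
[cite: LadnerLynchSelman1975, §3] [cite: AroraBarakCC2009, §4.2 (Def. 4.9)] -/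
theorem union_mem_PSPACE_of_complete (hB : IsComplete PSPACE B) {L₁ L₂ : Language Bool}
    (h₁ : L₁ ∈ PSPACE) (h₂ : L₂ ∈ PSPACE) : L₁ ⊔ L₂ ∈ PSPACE := by
  obtain ⟨f₁, hf₁, hr₁⟩ := karpReducible_of_isComplete hB h₁
  obtain ⟨f₂, hf₂, hr₂⟩ := karpReducible_of_isComplete hB h₂
  have hD : (sndP ⁻¹' HasBit true : Language Bool) ∈ Classes.P :=
    preimage_mem_P (HasBit_mem_P true) sndP_mem_FP
  have hmem := ttLang_mem_PRel (Q := iteFn (isNilFn ∘ sndP) (f₁ ∘ fstP) (f₂ ∘ fstP))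
    (q := Polynomial.C 2) (D := sndP ⁻¹' HasBit true) (twoQuery_mem_FP hf₁ hf₂) hD B
  have heq : ∀ x, x ∈ ttLang (iteFn (isNilFn ∘ sndP) (f₁ ∘ fstP) (f₂ ∘ fstP)) (Polynomial.C 2)
      (sndP ⁻¹' HasBit true) B ↔ x ∈ L₁ ∨ x ∈ L₂ := by
    intro x
    rw [mem_ttLang_iff, eval_C, ttBits_twoQuery]
    have e₁ : x ∈ L₁ ↔ B.boolIndicator (f₁ x) = true := (hr₁ x).trans (Set.mem_iff_boolIndicator _ _)
    have e₂ : x ∈ L₂ ↔ B.boolIndicator (f₂ x) = true := (hr₂ x).trans (Set.mem_iff_boolIndicator _ _)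
    rw [e₁, e₂]
    show sndP (boolPair x [B.boolIndicator (f₁ x), B.boolIndicator (f₂ x)]) ∈ HasBit true ↔ _
    rw [sndP_boolPair, mem_HasBit]
    cases B.boolIndicator (f₁ x) <;> cases B.boolIndicator (f₂ x) <;> simp
  have hset : L₁ ⊔ L₂ = ttLang (iteFn (isNilFn ∘ sndP) (f₁ ∘ fstP) (f₂ ∘ fstP)) (Polynomial.C 2)
      (sndP ⁻¹' HasBit true) B := Set.ext fun x => (heq x).symm
  rw [hset]
  exact PRel_subset_PSPACE_of_mem_PSPACE_holds hB.1 hmem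

/-- Finite intersections: a conjunction of two `PSPACE` predicates, set-builder form. [cite: AroraBarakCC2009, §4.2] -/
theorem setOf_and_mem_PSPACE_of_complete (hB : IsComplete PSPACE B) {P₁ P₂ : List Bool → Prop}
    (h₁ : {x | P₁ x} ∈ PSPACE) (h₂ : {x | P₂ x} ∈ PSPACE) : {x | P₁ x ∧ P₂ x} ∈ PSPACE :=
  inter_mem_PSPACE_of_complete hB h₁ h₂

/-- A disjunction of two `PSPACE` predicates, set-builder form. [cite: AroraBarakCC2009, §4.2] -/
theorem setOf_or_mem_PSPACE_of_complete (hB : IsComplete PSPACE B) {P₁ P₂ : List Bool → Prop}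
    (h₁ : {x | P₁ x} ∈ PSPACE) (h₂ : {x | P₂ x} ∈ PSPACE) : {x | P₁ x ∨ P₂ x} ∈ PSPACE :=
  union_mem_PSPACE_of_complete hB h₁ h₂

/-- An implication between two `PSPACE` predicates, set-builder form. [cite: AroraBarakCC2009, §4.2] -/
theorem setOf_imp_mem_PSPACE_of_complete (hB : IsComplete PSPACE B) {P₁ P₂ : List Bool → Prop}
    (h₁ : {x | P₁ x} ∈ PSPACE) (h₂ : {x | P₂ x} ∈ PSPACE) : {x | P₁ x → P₂ x} ∈ PSPACE := by
  have h := union_mem_PSPACE_of_complete hB (compl_mem_PSPACE h₁) h₂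
  have : {x | P₁ x → P₂ x} = ({x | P₁ x}ᶜ ⊔ {x | P₂ x} : Language Bool) :=
    Set.ext fun x => by
      show (P₁ x → P₂ x) ↔ ¬ P₁ x ∨ P₂ x
      exact imp_iff_not_or
  rw [this]
  exact h

end Complete

end Literature.Computability.Complexity

end
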